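import Literature.MathematicalPhysics.QuantumFieldTheory.Balaban1983to89.B9Eq3105CoordsDirichletBondY

/-!
# `Balaban1983to89.B9Eq3105CoordsDirichletBondGY` — T. Bałaban, *Propagators for lattice gauge theories in a background field*, Commun. Math. Phys. **99** (1985)
# 389–434 [Balaban1985BackgroundPropagators] (3.105) p. 414 («Δ_aG₀ = Σ_□ h_□² − Σ_□ K(h_□)G_□h_□ − Σ_□ (1 − ζ_□̃)DPD*h_□G_□h_□ − Σ_□ ζ_□̃D(P − P_□)D*h_□G_□h_□ − Σ_□ ζ_□̃P₁(∂h_□)G_□h_□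
# = I − R»), (3.101) p. 414, (3.87) p. 409, p. 409 l. 1–5 («the operators constructed for this sequence … G_□(U)»), (3.25) p. 394: ★★ **(3.105) AND ITS TRANSPOSE IN THE rows-19
# WALK RECORD's COORDINATES AT PRINT's DIRICHLET BOND LETTERS `G_□(U) = GDirBY 𝔮 𝔮⋆ Pl_□ B_□`, WITH print's `P_□`-TERM `Pl_□ = DP_□D*` AND ITS (3.101) COMMUTATOR `P₁(∂h_□)` AS
# GENERIC CUBE-INDEXED LETTERS** — the third edition of the families of ✓`B9Eq3105CoordsDirichletBondY` (v1: `Pl_□ := DPDsY parS G′_□`; v1.1: `DPDsY (parC □) G′_□`), now with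
# no commitment on the block structure of `P_□` (the (γ) letter of the N06 desk: node00-def-Y's `DPDsCubeGY i □ parS G′_□` over the cube sequence's blocks `𝔅_□`).

statement-level skeleton of published theorems with citation tags; proofs where landed; nothing here is a claim about the Yang–Mills mass gap

WHAT.  node00-def-Y's ✓`Node00.OpsYCubeDirInverseBond.eq3105Q_hT_GDirBY` ∕ ✓`eq3105QT_hT_GDirBY` prove (3.105) at `Δ_a[𝔮]` for ANY cube-indexed family of operators
`Pl_□(U)` and `P₁_□(U)` tied by the (3.101) commutator row `Pl_□ M_{h_□} = M_{h_□} Pl_□ + P₁_□`.  The N06 heads display the identity in the walk record's real coordinates with the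
remainder over ONE finite index `□ ⊕ □ ⊕ □ ⊕ □` (✓`B9Eq3105CoordsDirichletBondY`).  That file fixed print's `P_□`-term to def-Y's `DPDsY` (the member's block averaging
`Q′ ∕ Q′*` over 𝔅); print's `P_□` for the sequence `{Ω_n(□)}` (p. 409 l. 1–5, (3.25)) runs `Q′_□ ∕ Q′*_□` over the cube sequence's own blocks `𝔅_□` — node00-def-Y's (γ) word
(2026-08-31): `Pl_□ := DPDsCubeGY i □ parS G′_□` of `Node00.OpsYCubeProjectionG`.  THIS FILE states the families and the two coordinate identities ONCE for generic letters:
* §1 ★ `eq3105FamQGY` ∕ `eq3105FamQTGY` (the four printed families with `Pl_□ := Plc □`, `P₁(∂h_□) := P1c □`), the `Sum.elim` bookkeeping `sum_eq3105FamQGY` ∕ `sum_eq3105FamQTGY`,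
  and the dictionary `eq3105FamQGY_DPDsY` ∕ `eq3105FamQTGY_DPDsY`: at `Plc □ := DPDsY (parC □) (G′_□)`, `P1c □ := P1Y h_□ (parC □) (G′_□)` they ARE the v1.1 families (`rfl`).
* §2 ★★ `eq3105Q_coords_GDirBY_plc` ∕ ★★ `eq3105QT_coords_GDirBY_plc`: `S0coKq U · Σ_□ mulOp h_□ · GcoK(GDirBY 𝔮 𝔮⋆ (Plc □) B_□) U · mulOp h_□ = 1 − Σ_a eq3105FamQGY … a` and its transpose,
  displayed premises: the (3.101) row `hP1`, the bond support of `h_□` inside `B_□`, the regime `IsUnit (padDeltaLocBY 𝔮 𝔮⋆ (Plc □) B_□ U)`; §3 the member editions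
  `eq3105Q(T)_coords_GDirBY_member_plc` (the heads' `hlawsA`.3∕.4 shape).
HONEST SCOPE.  Identities and bookkeeping over landed letters (2 `def` + 8 thm, 0 `sorry`); no estimate ((3.106) is the certificate's displayed `hfacA`); count-neutral; N06 NOT discharged;
nothing continuum ∕ OS ∕ mass gap ∕ Clay.  Cell `pub-ymgap` (D-0062), node N06 [B9], seat `pub-ymgap-dag-n06-d` (g33), 2026-08-31; NEW file; nothing landed is modified.
-/

noncomputable section

namespace Literature.MathematicalPhysics.QuantumFieldTheory.Balaban1983to89.B9Eq3105CoordsDirichletBondGY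

open Node00
open B9Thm37Sum (mulOp)
open B9Thm37CubeCoverCommutators (cutMulY hTY)
open B9Eq3104CutoffCommutators (hBdY DPDsY P1Y DPDsY_comp_cutMulY)
open B9Eq3105OfLocalInverseQ (KhBQY S0coKq_eq_smul_coordAlgHomB GcoK_eq_smul_coordAlgHomB smul_mul_sum_smul_eq sum_smul_mul_smul_eq)
open B9Eq3105ZetaY (zetaY zetaY_eq_one_of_hTY_ne_zero)
open B9Eq3105CoordsDirichletBondY (eq3105FamQCY eq3105FamQTCY)
open B9Thm39ReadingCoords (cR39)
open B9CoReadingCoords (XBK GcoK)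
open B9WalkLettersBondLeib (coordAlgHomB mulOp_bond_eq_coordOpK)
open B6KLevelCensusIndexV1 (KIdx)
open B6Cover236MultiLevelBlocks (cubes)
open Node00.OpsYNablaBridge (chartY)
open Node00.OpsYQLetter (QLetterY QsLetterY)
open Node00.OpsYOps312OfRecordPar (S0coKq)
open Node00.OpsYCubeDirInverseBond (GDirBY padDeltaLocBY eq3105Q_hT_GDirBY eq3105QT_hT_GDirBY)
open scoped Matrix

variable {d ℓ : ℕ} {hd : 1 ≤ d + 1} {hL : Odd (ℓ + 1) ∧ 1 < ℓ + 1} {b₀ b₁ : ℝ}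
variable {𝔸 : Type} [NormedRing 𝔸] [NormedAlgebra ℂ 𝔸] [CompleteSpace 𝔸] [FiniteDimensional ℝ 𝔸] {κ : Type} [Fintype κ]
variable (i : KIdx d ℓ hd hL b₀ b₁) (b : Module.Basis κ ℝ 𝔸)

/-! ## §1 The four families of (3.105) at the Dirichlet bond letters with generic `Pl_□`, `P₁(∂h_□)` -/

section Families

variable (𝔮 : QLetterY 𝔸 i) (𝔮s : QsLetterY 𝔸 i) (parS : SiteParY 𝔸 i) (Gp : SiteOpY 𝔸 i)
  (Plc : ↥(cubes i.D.toDomains) → CfgY 𝔸 i → Module.End ℂ (FBondY i → 𝔸))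
  (P1c : ↥(cubes i.D.toDomains) → CfgY 𝔸 i → Module.End ℂ (FBondY i → 𝔸))
  (Bc : ↥(cubes i.D.toDomains) → Finset (FBondY i)) (U : CfgY 𝔸 i)

/-- ★ **THE FOUR FAMILIES OF (3.105) IN COORDINATES AT GENERIC CUBE LETTERS** `G_□(U) = GDirBY i 𝔮 𝔮⋆ (Pl_□) B_□ U`, `Pl_□ = Plc □` (print's `DP_□D*` for the sequence), `P₁(∂h_□) = P1c □`
(print's (3.101) commutator of `Pl_□` with `M_{h_□}`), `ζ_□̃ = zetaY i □`, the PHYSICAL `DPD*(U) = DPDsY parS Gp U`: `k = 1`: `φ(K[𝔮](h_□)G_□M_{h_□})`; `k = 2`: `φ((1 − M_ζ)DPD*(M_hG_□M_h))`;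
`k = 3`: `φ(M_ζ(DPD* − Pl_□)(M_hG_□M_h))`; `k = 4`: `φ(M_ζP₁(∂h_□)G_□M_h)`. [cite: Balaban1985BackgroundPropagators, (3.105) p.414, (3.87) p.409, (3.101) p.414, p.409 l.1–5] -/
def eq3105FamQGY : ↥(cubes i.D.toDomains) ⊕ ↥(cubes i.D.toDomains) ⊕ ↥(cubes i.D.toDomains) ⊕ ↥(cubes i.D.toDomains) → Module.End ℝ (XBK κ i → ℝ) :=
  Sum.elim (fun c => coordAlgHomB i b (KhBQY i (hTY i c) 𝔮 𝔮s U * GDirBY i 𝔮 𝔮s (Plc c) (Bc c) U * cutMulY (hBdY i (hTY i c))))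
    (Sum.elim (fun c => coordAlgHomB i b ((1 - cutMulY (hBdY i (zetaY i c))) * DPDsY i parS Gp U *
        (cutMulY (hBdY i (hTY i c)) * GDirBY i 𝔮 𝔮s (Plc c) (Bc c) U * cutMulY (hBdY i (hTY i c)))))
      (Sum.elim (fun c => coordAlgHomB i b (cutMulY (hBdY i (zetaY i c)) * (DPDsY i parS Gp U - Plc c U) *
          (cutMulY (hBdY i (hTY i c)) * GDirBY i 𝔮 𝔮s (Plc c) (Bc c) U * cutMulY (hBdY i (hTY i c)))))
        (fun c => coordAlgHomB i b (cutMulY (hBdY i (zetaY i c)) * P1c c U * GDirBY i 𝔮 𝔮s (Plc c) (Bc c) U * cutMulY (hBdY i (hTY i c))))))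

/-- the TRANSPOSED reading's four families at generic cube letters (signed so that the transposed identity reads `… = 1 − Σ_a`). (transposed reading — bookkeeping)
[cite: Balaban1985BackgroundPropagators, (3.105) p.414, (3.87) p.409, (3.101) p.414] -/
def eq3105FamQTGY : ↥(cubes i.D.toDomains) ⊕ ↥(cubes i.D.toDomains) ⊕ ↥(cubes i.D.toDomains) ⊕ ↥(cubes i.D.toDomains) → Module.End ℝ (XBK κ i → ℝ) :=
  Sum.elim (fun c => -coordAlgHomB i b (cutMulY (hBdY i (hTY i c)) * GDirBY i 𝔮 𝔮s (Plc c) (Bc c) U * KhBQY i (hTY i c) 𝔮 𝔮s U))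
    (Sum.elim (fun c => -coordAlgHomB i b (cutMulY (hBdY i (hTY i c)) * GDirBY i 𝔮 𝔮s (Plc c) (Bc c) U * P1c c U))
      (Sum.elim (fun c => coordAlgHomB i b (cutMulY (hBdY i (hTY i c)) * GDirBY i 𝔮 𝔮s (Plc c) (Bc c) U * cutMulY (hBdY i (hTY i c)) *
          (cutMulY (hBdY i (zetaY i c)) * (DPDsY i parS Gp U - Plc c U))))
        (fun c => coordAlgHomB i b (cutMulY (hBdY i (hTY i c)) * GDirBY i 𝔮 𝔮s (Plc c) (Bc c) U * cutMulY (hBdY i (hTY i c)) *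
          ((1 - cutMulY (hBdY i (zetaY i c))) * DPDsY i parS Gp U)))))

omit [FiniteDimensional ℝ 𝔸] in
/-- the `Sum.elim` bookkeeping: `Σ_a eq3105FamQGY a = Σ_□ R¹_□ + (Σ_□ R²_□ + (Σ_□ R³_□ + Σ_□ R⁴_□))`. [cite: Balaban1985BackgroundPropagators, (3.105) p.414, bookkeeping] -/
theorem sum_eq3105FamQGY :
    ∑ a, eq3105FamQGY i b 𝔮 𝔮s parS Gp Plc P1c Bc U a =
      ∑ c, coordAlgHomB i b (KhBQY i (hTY i c) 𝔮 𝔮s U * GDirBY i 𝔮 𝔮s (Plc c) (Bc c) U * cutMulY (hBdY i (hTY i c)))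
        + (∑ c, coordAlgHomB i b ((1 - cutMulY (hBdY i (zetaY i c))) * DPDsY i parS Gp U *
            (cutMulY (hBdY i (hTY i c)) * GDirBY i 𝔮 𝔮s (Plc c) (Bc c) U * cutMulY (hBdY i (hTY i c))))
        + (∑ c, coordAlgHomB i b (cutMulY (hBdY i (zetaY i c)) * (DPDsY i parS Gp U - Plc c U) *
            (cutMulY (hBdY i (hTY i c)) * GDirBY i 𝔮 𝔮s (Plc c) (Bc c) U * cutMulY (hBdY i (hTY i c))))
        + ∑ c, coordAlgHomB i b (cutMulY (hBdY i (zetaY i c)) * P1c c U * GDirBY i 𝔮 𝔮s (Plc c) (Bc c) U * cutMulY (hBdY i (hTY i c))))) := by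
  simp only [eq3105FamQGY, Fintype.sum_sum_type, Sum.elim_inl, Sum.elim_inr]

omit [FiniteDimensional ℝ 𝔸] in
/-- the same for the transposed families. [cite: Balaban1985BackgroundPropagators, (3.105) p.414, bookkeeping] -/
theorem sum_eq3105FamQTGY :
    ∑ a, eq3105FamQTGY i b 𝔮 𝔮s parS Gp Plc P1c Bc U a =
      ∑ c, -coordAlgHomB i b (cutMulY (hBdY i (hTY i c)) * GDirBY i 𝔮 𝔮s (Plc c) (Bc c) U * KhBQY i (hTY i c) 𝔮 𝔮s U)
        + (∑ c, -coordAlgHomB i b (cutMulY (hBdY i (hTY i c)) * GDirBY i 𝔮 𝔮s (Plc c) (Bc c) U * P1c c U)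
        + (∑ c, coordAlgHomB i b (cutMulY (hBdY i (hTY i c)) * GDirBY i 𝔮 𝔮s (Plc c) (Bc c) U * cutMulY (hBdY i (hTY i c)) *
            (cutMulY (hBdY i (zetaY i c)) * (DPDsY i parS Gp U - Plc c U)))
        + ∑ c, coordAlgHomB i b (cutMulY (hBdY i (hTY i c)) * GDirBY i 𝔮 𝔮s (Plc c) (Bc c) U * cutMulY (hBdY i (hTY i c)) *
            ((1 - cutMulY (hBdY i (zetaY i c))) * DPDsY i parS Gp U)))) := by
  simp only [eq3105FamQTGY, Fintype.sum_sum_type, Sum.elim_inl, Sum.elim_inr]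

omit [FiniteDimensional ℝ 𝔸] in
/-- dictionary: at `Pl_□ := DPDsY (parC □) G′_□`, `P₁(∂h_□) := P1Y h_□ (parC □) G′_□` the generic families ARE the v1.1 families. [cite: Balaban1985BackgroundPropagators, (3.105) p.414, bookkeeping] -/
theorem eq3105FamQGY_DPDsY (parC : ↥(cubes i.D.toDomains) → SiteParY 𝔸 i) (Gpc : ↥(cubes i.D.toDomains) → SiteOpY 𝔸 i) :
    eq3105FamQGY i b 𝔮 𝔮s parS Gp (fun c => DPDsY i (parC c) (Gpc c)) (fun c U => P1Y i (hTY i c) (parC c) (Gpc c) U) Bc U =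
      eq3105FamQCY i b 𝔮 𝔮s parS Gp parC Gpc Bc U := rfl

omit [FiniteDimensional ℝ 𝔸] in
/-- dictionary, transposed families. [cite: Balaban1985BackgroundPropagators, (3.105) p.414, bookkeeping] -/
theorem eq3105FamQTGY_DPDsY (parC : ↥(cubes i.D.toDomains) → SiteParY 𝔸 i) (Gpc : ↥(cubes i.D.toDomains) → SiteOpY 𝔸 i) :
    eq3105FamQTGY i b 𝔮 𝔮s parS Gp (fun c => DPDsY i (parC c) (Gpc c)) (fun c U => P1Y i (hTY i c) (parC c) (Gpc c) U) Bc U =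
      eq3105FamQTCY i b 𝔮 𝔮s parS Gp parC Gpc Bc U := rfl

end Families

/-! ## §2 (3.105) and its transpose in the record's coordinates at the Dirichlet bond letters with generic `Pl_□`, `P₁(∂h_□)` -/

section Coords

variable (B : B9.Backgrounds) (cfg : B.Cfg → CfgY 𝔸 i)
variable (𝔮 : QLetterY 𝔸 i) (𝔮s : QsLetterY 𝔸 i) (parS : SiteParY 𝔸 i) (Gp : SiteOpY 𝔸 i)

/-- ★★ **(3.105) IN THE WALK RECORD's COORDINATES AT PRINT's DIRICHLET BOND LETTERS, GENERIC `P_□`-TERM**: with `h_□` read on the bond carrier, `Δ_a[𝔮]` as `S0coKq … Gp`, the cube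
letters `G_□(U) = GDirBY i 𝔮 𝔮⋆ (Pl_□) B_□` read as `GcoK`, `ζ_□̃ = zetaY i □`: `S0coKq U · Σ_□ mulOp h_□ · GcoK(G_□) U · mulOp h_□ = 1 − Σ_a eq3105FamQGY … a`.  Displayed premises: the (3.101)
commutator row `hP1` (at print's pins a theorem: ✓`DPDsY_comp_cutMulY`, def-Y's `DPDsCubeGY_comp_cutMulY`), the bond support of `h_□` inside `B_□`, and the regime `IsUnit (padDeltaLocBY …)`
(Thm 3.3 ∕ Cor. 3.6 for the sequence). [cite: Balaban1985BackgroundPropagators, (3.105) p.414, (3.101) p.414, (3.87) p.409, p.409 l.1–5, (3.42) p.397, p.415] -/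
theorem eq3105Q_coords_GDirBY_plc (hc : cR39 b ≠ 0) (U₁ : B.Cfg)
    (Plc : ↥(cubes i.D.toDomains) → CfgY 𝔸 i → Module.End ℂ (FBondY i → 𝔸)) (P1c : ↥(cubes i.D.toDomains) → CfgY 𝔸 i → Module.End ℂ (FBondY i → 𝔸))
    (hP1 : ∀ c, Plc c (cfg U₁) * cutMulY (hBdY i (hTY i c)) = cutMulY (hBdY i (hTY i c)) * Plc c (cfg U₁) + P1c c (cfg U₁))
    (Bc : ↥(cubes i.D.toDomains) → Finset (FBondY i)) (hB : ∀ c bd, hBdY i (hTY i c) bd ≠ 0 → bd ∈ Bc c)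
    (hU : ∀ c, IsUnit (padDeltaLocBY i 𝔮 𝔮s (Plc c) (Bc c) (cfg U₁))) :
    S0coKq i b B cfg 𝔮 𝔮s parS Gp U₁ *
        (∑ c, mulOp (fun p : XBK κ i => hTY i c (chartY i p.1.src)) * GcoK i b B cfg (GDirBY i 𝔮 𝔮s (Plc c) (Bc c)) U₁ *
          mulOp (fun p : XBK κ i => hTY i c (chartY i p.1.src))) =
      1 - ∑ a, eq3105FamQGY i b 𝔮 𝔮s parS Gp Plc P1c Bc (cfg U₁) a := by
  have eM : ∀ c : ↥(cubes i.D.toDomains),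
      mulOp (fun p : XBK κ i => hTY i c (chartY i p.1.src)) = coordAlgHomB i b (cutMulY (𝔸 := 𝔸) (hBdY i (hTY i c))) :=
    fun c => mulOp_bond_eq_coordOpK i b (hTY i c)
  simp only [eM, S0coKq_eq_smul_coordAlgHomB, GcoK_eq_smul_coordAlgHomB]
  rw [smul_mul_sum_smul_eq i b hc, eq3105Q_hT_GDirBY i 𝔮 𝔮s parS Gp (cfg U₁) (fun c => zetaY i c)
    (fun c z hz => zetaY_eq_one_of_hTY_ne_zero i c hz) Plc (fun c => P1c c (cfg U₁)) hP1 Bc hB hU, sum_eq3105FamQGY]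
  simp only [map_sub, map_sum, map_one]
  abel

/-- ★★ **THE TRANSPOSED (3.105) IN THE SAME CURRENCY, GENERIC `P_□`-TERM**: `Σ_□ mulOp h_□ · GcoK(G_□) U · mulOp h_□ · S0coKq U = 1 − Σ_a eq3105FamQTGY … a`.
(transposed reading — bookkeeping) [cite: Balaban1985BackgroundPropagators, (3.105) p.414, (3.101) p.414, (3.87) p.409, p.409 l.1–5] -/
theorem eq3105QT_coords_GDirBY_plc (hc : cR39 b ≠ 0) (U₁ : B.Cfg)
    (Plc : ↥(cubes i.D.toDomains) → CfgY 𝔸 i → Module.End ℂ (FBondY i → 𝔸)) (P1c : ↥(cubes i.D.toDomains) → CfgY 𝔸 i → Module.End ℂ (FBondY i → 𝔸))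
    (hP1 : ∀ c, Plc c (cfg U₁) * cutMulY (hBdY i (hTY i c)) = cutMulY (hBdY i (hTY i c)) * Plc c (cfg U₁) + P1c c (cfg U₁))
    (Bc : ↥(cubes i.D.toDomains) → Finset (FBondY i)) (hB : ∀ c bd, hBdY i (hTY i c) bd ≠ 0 → bd ∈ Bc c)
    (hU : ∀ c, IsUnit (padDeltaLocBY i 𝔮 𝔮s (Plc c) (Bc c) (cfg U₁))) :
    (∑ c, mulOp (fun p : XBK κ i => hTY i c (chartY i p.1.src)) * GcoK i b B cfg (GDirBY i 𝔮 𝔮s (Plc c) (Bc c)) U₁ *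
          mulOp (fun p : XBK κ i => hTY i c (chartY i p.1.src))) * S0coKq i b B cfg 𝔮 𝔮s parS Gp U₁ =
      1 - ∑ a, eq3105FamQTGY i b 𝔮 𝔮s parS Gp Plc P1c Bc (cfg U₁) a := by
  have eM : ∀ c : ↥(cubes i.D.toDomains),
      mulOp (fun p : XBK κ i => hTY i c (chartY i p.1.src)) = coordAlgHomB i b (cutMulY (𝔸 := 𝔸) (hBdY i (hTY i c))) :=
    fun c => mulOp_bond_eq_coordOpK i b (hTY i c)
  simp only [eM, S0coKq_eq_smul_coordAlgHomB, GcoK_eq_smul_coordAlgHomB]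
  rw [sum_smul_mul_smul_eq i b hc, eq3105QT_hT_GDirBY i 𝔮 𝔮s parS Gp (cfg U₁) (fun c => zetaY i c)
    (fun c z hz => zetaY_eq_one_of_hTY_ne_zero i c hz) Plc (fun c => P1c c (cfg U₁)) hP1 Bc hB hU, sum_eq3105FamQTGY]
  simp only [map_sub, map_add, map_sum, map_one, Finset.sum_neg_distrib]
  abel

end Coords

/-! ## §3 At a k-level member, with the rows-19 record's partition letter `hWalkBY x □` (the heads' `hlawsA`.3∕.4 shape at the (γ) pins) -/

section Member

open B9PinMembersKLevelV1 (MemberY)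
open B9WalkLettersOps310 (hWalkBY)

variable {Mstar : ℕ} (x : MemberY d ℓ hd hL b₀ b₁ Mstar) (B : B9.Backgrounds) (cfg : B.Cfg → CfgY 𝔸 x.toKIdx)
variable (𝔮 : QLetterY 𝔸 x.toKIdx) (𝔮s : QsLetterY 𝔸 x.toKIdx) (parS : SiteParY 𝔸 x.toKIdx) (Gp : SiteOpY 𝔸 x.toKIdx)

/-- ★★ (3.105) in the rows-19 record's coordinates AT A MEMBER with generic `Pl_□`, `P₁(∂h_□)`, the partition read as `hWalkBY x □`.
[cite: Balaban1985BackgroundPropagators, (3.105) p.414, (3.101) p.414, (3.87) p.409, p.409 l.1–5] -/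
theorem eq3105Q_coords_GDirBY_member_plc (hc : cR39 b ≠ 0) (U₁ : B.Cfg)
    (Plc : ↥(cubes x.toKIdx.D.toDomains) → CfgY 𝔸 x.toKIdx → Module.End ℂ (FBondY x.toKIdx → 𝔸))
    (P1c : ↥(cubes x.toKIdx.D.toDomains) → CfgY 𝔸 x.toKIdx → Module.End ℂ (FBondY x.toKIdx → 𝔸))
    (hP1 : ∀ c, Plc c (cfg U₁) * cutMulY (hBdY x.toKIdx (hTY x.toKIdx c)) = cutMulY (hBdY x.toKIdx (hTY x.toKIdx c)) * Plc c (cfg U₁) + P1c c (cfg U₁))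
    (Bc : ↥(cubes x.toKIdx.D.toDomains) → Finset (FBondY x.toKIdx)) (hB : ∀ c bd, hBdY x.toKIdx (hTY x.toKIdx c) bd ≠ 0 → bd ∈ Bc c)
    (hU : ∀ c, IsUnit (padDeltaLocBY x.toKIdx 𝔮 𝔮s (Plc c) (Bc c) (cfg U₁))) :
    S0coKq x.toKIdx b B cfg 𝔮 𝔮s parS Gp U₁ *
        (∑ c, mulOp (hWalkBY (κ := κ) x c) * GcoK x.toKIdx b B cfg (GDirBY x.toKIdx 𝔮 𝔮s (Plc c) (Bc c)) U₁ * mulOp (hWalkBY (κ := κ) x c)) =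
      1 - ∑ a, eq3105FamQGY x.toKIdx b 𝔮 𝔮s parS Gp Plc P1c Bc (cfg U₁) a :=
  eq3105Q_coords_GDirBY_plc x.toKIdx b B cfg 𝔮 𝔮s parS Gp hc U₁ Plc P1c hP1 Bc hB hU

/-- ★★ the transposed reading at a member with generic `Pl_□`, `P₁(∂h_□)`. (transposed reading — bookkeeping)
[cite: Balaban1985BackgroundPropagators, (3.105) p.414, (3.101) p.414, (3.87) p.409, p.409 l.1–5] -/
theorem eq3105QT_coords_GDirBY_member_plc (hc : cR39 b ≠ 0) (U₁ : B.Cfg)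
    (Plc : ↥(cubes x.toKIdx.D.toDomains) → CfgY 𝔸 x.toKIdx → Module.End ℂ (FBondY x.toKIdx → 𝔸))
    (P1c : ↥(cubes x.toKIdx.D.toDomains) → CfgY 𝔸 x.toKIdx → Module.End ℂ (FBondY x.toKIdx → 𝔸))
    (hP1 : ∀ c, Plc c (cfg U₁) * cutMulY (hBdY x.toKIdx (hTY x.toKIdx c)) = cutMulY (hBdY x.toKIdx (hTY x.toKIdx c)) * Plc c (cfg U₁) + P1c c (cfg U₁))
    (Bc : ↥(cubes x.toKIdx.D.toDomains) → Finset (FBondY x.toKIdx)) (hB : ∀ c bd, hBdY x.toKIdx (hTY x.toKIdx c) bd ≠ 0 → bd ∈ Bc c)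
    (hU : ∀ c, IsUnit (padDeltaLocBY x.toKIdx 𝔮 𝔮s (Plc c) (Bc c) (cfg U₁))) :
    (∑ c, mulOp (hWalkBY (κ := κ) x c) * GcoK x.toKIdx b B cfg (GDirBY x.toKIdx 𝔮 𝔮s (Plc c) (Bc c)) U₁ * mulOp (hWalkBY (κ := κ) x c)) *
        S0coKq x.toKIdx b B cfg 𝔮 𝔮s parS Gp U₁ =
      1 - ∑ a, eq3105FamQTGY x.toKIdx b 𝔮 𝔮s parS Gp Plc P1c Bc (cfg U₁) a :=
  eq3105QT_coords_GDirBY_plc x.toKIdx b B cfg 𝔮 𝔮s parS Gp hc U₁ Plc P1c hP1 Bc hB hU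

end Member

end Literature.MathematicalPhysics.QuantumFieldTheory.Balaban1983to89.B9Eq3105CoordsDirichletBondGY

end
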